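import Literature.Geometry.Riemannian.HyperboloidModel
import Literature.Geometry.Riemannian.RicciFlowScalarCurvatureProofs
import HarnessLib

/-!
# Constant sectional curvature `c` in dimension `m` gives `Ric = (m-1) c g` and `S = m(m-1)c`;
# hyperbolic space is Einstein with `Ric = -(m-1) g`

Topic `Geometry/Riemannian`; everything is PROVED (no definition, no named fact). Frame-free
companions of `HasConstantSectionalCurvatureWith.ricci_frame_eq` / `.scalarCurvature_eq_of_basis`
(`ChangGurskyYangProofs.lean`, stated on an orthonormal basis; not imported here to keep the
Ricci-flow / Yamabe development out of the closure of the hyperbolic model):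

* `HasConstantSectionalCurvatureWith.ricci_eq_smul_of_isRiemannian` — for a positive definite metric
  `g` on a model space of dimension `m` whose Levi-Civita connection has constant sectional
  curvature `c` (`Rm = c (g_{jk}g_{il} - g_{ik}g_{jl})`, Lee 2018, Prop. 8.36), the Ricci tensor is
  `Ric_x(Y, Z) = (m - 1) c g_x(Y, Z)` ("`Rc = (n-1) c g`", ibid.): trace in a `g_x`-orthonormal
  basis (`ricci_eq_sum_of_isOrthonormalFrame`) and the orthonormal expansion
  `Σᵢ g(bᵢ, Z) g(Y, bᵢ) = g(Y, Z)` (O'Neill 1983, Ch. 2, Lemma 25);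
* `HasConstantSectionalCurvatureWith.scalarCurvature_eq_of_isRiemannian` — `S = m (m - 1) c`;
* **`Hyperboloid.ricci_eq`**, **`Hyperboloid.scalarCurvature_eq`** — **hyperbolic space
  `(U, Hyperboloid.metric U)` (graph chart of the hyperboloid model over an inner product space
  `V` of dimension `m`, `HyperboloidModel.lean`, constant curvature `-1`) is Einstein with
  `Ric = -(m - 1) g` and `S = -m(m - 1)`** (Lee 2018, Thm. 8.34 (c) with Prop. 8.36; Li–Qing–Shi
  2017, Def. 2.1: "Einstein, that is, `Ric[g⁺] = -(n-1) g⁺`" — the normalisation of conformally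
  compact Einstein manifolds is that of `ℍⁿ`, their model and rigidity case, ibid. Thm. 1.7). In
  dimension `m = 5` this is `Ric = -4 g`, the Einstein equation of the Poincaré–Einstein fillings of
  `liQingShi_pinching_five` (`Hyperboloid.ricci_eq_neg_four_smul`).

## References

* J. M. Lee, *Introduction to Riemannian Manifolds*, 2nd ed. (2018), Thm. 8.34 (c), Prop. 8.36.
  [Lee2018]
* B. O'Neill, *Semi-Riemannian geometry* (1983), Ch. 2, Lemma 25; Ch. 3, Lemma 3.52. [ONeill1983]
* G. Li, J. Qing, Y. Shi, Trans. Amer. Math. Soc. 369 (2017), Def. 2.1, Thm. 1.7. [LiQingShi2017]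
-/

noncomputable section

open Bundle Module
open scoped Manifold ContDiff Topology

namespace Literature.Geometry.Riemannian

open Literature.Geometry.Lorentzian (PseudoRiemannianMetric)
open Literature.Geometry.Lorentzian.PseudoRiemannianMetric

section General

variable {E : Type*} [NormedAddCommGroup E] [NormedSpace ℝ E] {H : Type*} [TopologicalSpace H]
  {I : ModelWithCorners ℝ E H} {M : Type*} [TopologicalSpace M] [ChartedSpace H M]
  [IsManifold I ∞ M] {n : ℕ∞ω} [FiniteDimensional ℝ E]
  {g : PseudoRiemannianMetric I n E (TangentSpace I : M → Type _)}
  {cov : CovariantDerivative I E (TangentSpace I : M → Type _)}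

omit [FiniteDimensional ℝ E] in
/-- **Orthonormal Parseval**: `Σᵢ g(bᵢ, Z) g(Y, bᵢ) = g(Y, Z)` in a `g_x`-orthonormal basis
(expand `Y = Σ g(Y, bᵢ) bᵢ`, O'Neill 1983, Ch. 2, Lemma 25). [cite: ONeill1983, Ch. 2, Lemma 25 (p. 50)] -/
theorem sum_val_mul_val_of_isOrthonormalFrame {x : M} {ι : Type*} [Fintype ι]
    (b : Basis ι ℝ (TangentSpace I x)) (hb : g.IsOrthonormalFrame x b) (Y Z : TangentSpace I x) :
    ∑ i, g.val x (b i) Z * g.val x Y (b i) = g.val x Y Z := by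
  classical
  have hY : Y = ∑ i, g.val x Y (b i) • b i := by
    conv_lhs => rw [← b.sum_repr Y]
    simp only [g.basis_repr_of_isOrthonormalFrame b hb]
  conv_rhs => rw [hY]
  rw [map_sum, _root_.sum_apply]
  refine Finset.sum_congr rfl fun i _ ↦ ?_
  rw [map_smul, _root_.smul_apply, smul_eq_mul, mul_comm]

/-- **`Ric = (m-1) c g` for constant sectional curvature `c` in dimension `m`** (Lee 2018,
Prop. 8.36: "`Rc = (n-1) c g`"), frame-free, for a positive definite metric (so that orthonormal
bases exist) and any covariant derivative `cov` with `Rm = c (g_{jk}g_{il} - g_{ik}g_{jl})`: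
`Ric_x(Y, Z) = (m - 1) c g_x(Y, Z)`. [cite: Lee2018, Prop. 8.36] -/
theorem _root_.Literature.Geometry.Lorentzian.PseudoRiemannianMetric.HasConstantSectionalCurvatureWith.ricci_eq_smul_of_isRiemannian
    {c : ℝ} (h : g.HasConstantSectionalCurvatureWith cov c) (hg : g.IsRiemannian) {m : ℕ}
    (hm : finrank ℝ E = m) (x : M) (Y Z : TangentSpace I x) :
    cov.ricci x Y Z = ((m : ℝ) - 1) * c * g.val x Y Z := by
  obtain ⟨b, hb⟩ := g.exists_basis_isOrthonormalFrame (x := x) (fun v hv ↦ hg x v hv) hm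
  rw [g.ricci_eq_sum_of_isOrthonormalFrame b hb cov Y Z]
  have hsummand : ∀ i, g.curvatureForm cov x (b i) Y Z (b i) =
      c * g.val x Y Z - c * (g.val x (b i) Z * g.val x Y (b i)) := fun i ↦ by
    rw [h.curvatureForm_eq, hb.1 i]
    ring
  simp only [hsummand, Finset.sum_sub_distrib, Finset.sum_const, Finset.card_univ, Fintype.card_fin,
    nsmul_eq_mul, ← Finset.mul_sum, sum_val_mul_val_of_isOrthonormalFrame b hb Y Z]
  ring

/-- **`S = m(m-1)c` for constant sectional curvature `c` in dimension `m`**, for the Levi-Civita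
connection of a positive definite metric (trace of `Ric = (m-1) c g`). [cite: Lee2018, Prop. 8.36] -/
theorem _root_.Literature.Geometry.Lorentzian.PseudoRiemannianMetric.HasConstantSectionalCurvatureWith.scalarCurvature_eq_of_isRiemannian
    [g.HasLeviCivita] {c : ℝ} (h : g.HasConstantSectionalCurvatureWith g.leviCivita c)
    (hg : g.IsRiemannian) {m : ℕ} (hm : finrank ℝ E = m) (x : M) :
    g.scalarCurvature x = (m : ℝ) * ((m : ℝ) - 1) * c := by
  obtain ⟨b, hb⟩ := g.exists_basis_isOrthonormalFrame (x := x) (fun v hv ↦ hg x v hv) hm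
  rw [scalarCurvature, g.trace_eq_sum_of_isOrthonormalFrame b hb (g.ricci x)]
  have hric : ∀ i, g.ricci x (b i) (b i) = ((m : ℝ) - 1) * c := fun i ↦ by
    rw [ricci_apply, h.ricci_eq_smul_of_isRiemannian hg hm x (b i) (b i), hb.1 i, mul_one]
  simp only [hric, Finset.sum_const, Finset.card_univ, Fintype.card_fin, nsmul_eq_mul]
  ring

end General

/-! ### Hyperbolic space is Einstein: `Ric = -(m-1) g`, `S = -m(m-1)` -/

namespace Hyperboloid

variable {V : Type*} [NormedAddCommGroup V] [InnerProductSpace ℝ V] [FiniteDimensional ℝ V]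
  [CompleteSpace V] {U : TopologicalSpace.Opens V}

/-- **Hyperbolic space is Einstein with `Ric = -(m-1) g`** (`m = dim V`): the hyperbolic metric
`Hyperboloid.metric U` has constant sectional curvature `-1`
(`hasConstantSectionalCurvatureWith_leviCivita`, Lee 2018, Thm. 8.34 (c)), hence
`Ric_x(Y, Z) = -(m - 1) g_x(Y, Z)` (Prop. 8.36) — the Einstein normalisation
"`Ric[g⁺] = -(n-1) g⁺`" of conformally compact Einstein manifolds (Li–Qing–Shi 2017, Def. 2.1),
realised by their model `ℍⁿ` (ibid., Thm. 1.7). [cite: Lee2018, Thm. 8.34 (c) and Prop. 8.36]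
[cite: LiQingShi2017, Def. 2.1] -/
theorem ricci_eq [(metric U).HasLeviCivita] {m : ℕ} (hm : finrank ℝ V = m) (x : U)
    (Y Z : TangentSpace 𝓘(ℝ, V) x) :
    (metric U).ricci x Y Z = -((m : ℝ) - 1) * (metric U).val x Y Z := by
  rw [ricci_apply, (hasConstantSectionalCurvatureWith_leviCivita (U := U)).ricci_eq_smul_of_isRiemannian
    isRiemannian_metric hm x Y Z]
  ring

/-- The same as an identity of bilinear forms: `Ric_x = -(m-1) • g_x`. [cite: Lee2018, Prop. 8.36] -/
theorem ricci_eq_smul [(metric U).HasLeviCivita] {m : ℕ} (hm : finrank ℝ V = m) (x : U) :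
    (metric U).ricci x = (-((m : ℝ) - 1)) • (metric U).toBilinForm x := by
  ext Y Z
  rw [ricci_eq hm x Y Z]
  simp [PseudoRiemannianMetric.toBilinForm_apply]

/-- **The scalar curvature of hyperbolic space is `S = -m(m-1)`** (`m = dim V`; Li–Qing–Shi 2017,
§2: "`R[g⁺] = -n(n-1)`"). [cite: Lee2018, Prop. 8.36] [cite: LiQingShi2017, §2 (p. 6)] -/
theorem scalarCurvature_eq [(metric U).HasLeviCivita] {m : ℕ} (hm : finrank ℝ V = m) (x : U) :
    (metric U).scalarCurvature x = -((m : ℝ) * ((m : ℝ) - 1)) := by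
  rw [(hasConstantSectionalCurvatureWith_leviCivita (U := U)).scalarCurvature_eq_of_isRiemannian
    isRiemannian_metric hm x]
  ring

/-- **Hyperbolic `5`-space satisfies the Einstein equation `Ric = -4 g`** of the Poincaré–Einstein
fillings of `liQingShi_pinching_five` (`dim V = 5`). [cite: LiQingShi2017, Def. 2.1] -/
theorem ricci_eq_neg_four_smul [(metric U).HasLeviCivita] (h5 : finrank ℝ V = 5) (x : U) :
    (metric U).ricci x = (-4 : ℝ) • (metric U).toBilinForm x := by
  rw [ricci_eq_smul h5 x]
  norm_num

end Hyperboloid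

end Literature.Geometry.Riemannian
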